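import Literature.ModelTheory.ExponentialFields.PilaWilkieUniformReparamLow
import Literature.ModelTheory.ExponentialFields.PilaWilkieCubeMaps
import HarnessLib

/-!
# Two small tools for the uniform reparametrization: monotonicity in the order, and composition into open sets

Topic `Literature/ModelTheory/ExponentialFields`; proof file in the cone of the named fact
`PilaWilkie2006_thm_1_8`.

* `uniformReparam_mono` — the uniform `r`-reparametrization property `UR(r, ℓ)` (inline, as
  in `PilaWilkieUniformReparamLow`) is monotone in `r`: `UR(r', ℓ) ⇒ UR(r, ℓ)` for `r ≤ r'`;
* `contDiffOn_norm_iteratedFDeriv_comp_open` — the composition estimate of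
  `PilaWilkieCubeMaps` (`‖D^q(φ ∘ ψ)‖ ≤ q!·C·D^q`) for `φ` of class `C^r` with bounded
  derivatives on an arbitrary **open** set containing the image of the chart `ψ` (Bhardwaj–van
  den Dries 2022, Lemma 4.4 shape; needed for `F_ψ ∘ χ` with `F_ψ` smooth only on `V`).

Nothing here is a named fact; no definitions.

## References

* N. Bhardwaj, L. van den Dries, *On the Pila–Wilkie theorem*, Expo. Math. 40 (2022),
  Lemma 4.4, §7. [BhardwajVanDenDries2022]
-/

noncomputable section

open Set FirstOrder FirstOrder.Language Filter Topology

namespace Literature.ModelTheory.ExponentialFields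

/-! ### Monotonicity of `UR(r, ℓ)` in `r`, and composition with charts into open sets -/

section Mono

variable {L : Language} [L.Structure ℝ]

/-- Local notation: the open unit cube `(0,1)^ℓ`. -/
local notation "𝕀^" ℓ:max => (Set.pi Set.univ fun _ : Fin ℓ => Set.Ioo (0 : ℝ) 1)

/-- **`UR(r', ℓ) ⇒ UR(r, ℓ)` for `r ≤ r'`**: the uniform `r`-reparametrization property is
monotone in the smoothness order. [folklore] -/
theorem uniformReparam_mono {r r' ℓ : ℕ} (hr : r ≤ r')
    (h : ∀ (n m : ℕ) (F : Fin n → (Fin m → ℝ) → (Fin ℓ → ℝ) → ℝ),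
      (∀ l, IsDefinableFamily L (F l)) → (∀ l v, ∀ x ∈ 𝕀^ℓ, |F l v x| ≤ 1) →
      ∃ (κ : Type) (_ : Fintype κ) (ψ : κ → (Fin m → ℝ) → (Fin ℓ → ℝ) → (Fin ℓ → ℝ)),
        (∀ j c, IsDefinableFamily L (fun v x => ψ j v x c)) ∧
        ∀ v, (∀ j, MapsTo (ψ j v) (𝕀^ℓ) (𝕀^ℓ)) ∧ (⋃ j, ψ j v '' 𝕀^ℓ) = 𝕀^ℓ ∧
          (∀ j c, ContDiffOn ℝ r' (fun x => ψ j v x c) (𝕀^ℓ)) ∧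
          (∀ j c, ∀ q ≤ r', ∀ x ∈ 𝕀^ℓ, ‖iteratedFDeriv ℝ q (fun x => ψ j v x c) x‖ ≤ 1) ∧
          (∀ j l, ContDiffOn ℝ r' (fun x => F l v (ψ j v x)) (𝕀^ℓ)) ∧
          (∀ j l, ∀ q ≤ r', ∀ x ∈ 𝕀^ℓ, ‖iteratedFDeriv ℝ q (fun x => F l v (ψ j v x)) x‖ ≤ 1))
    (n m : ℕ) (F : Fin n → (Fin m → ℝ) → (Fin ℓ → ℝ) → ℝ)
    (hF : ∀ l, IsDefinableFamily L (F l)) (hbd : ∀ l v, ∀ x ∈ 𝕀^ℓ, |F l v x| ≤ 1) :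
    ∃ (κ : Type) (_ : Fintype κ) (ψ : κ → (Fin m → ℝ) → (Fin ℓ → ℝ) → (Fin ℓ → ℝ)),
      (∀ j c, IsDefinableFamily L (fun v x => ψ j v x c)) ∧
      ∀ v, (∀ j, MapsTo (ψ j v) (𝕀^ℓ) (𝕀^ℓ)) ∧ (⋃ j, ψ j v '' 𝕀^ℓ) = 𝕀^ℓ ∧
        (∀ j c, ContDiffOn ℝ r (fun x => ψ j v x c) (𝕀^ℓ)) ∧
        (∀ j c, ∀ q ≤ r, ∀ x ∈ 𝕀^ℓ, ‖iteratedFDeriv ℝ q (fun x => ψ j v x c) x‖ ≤ 1) ∧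
        (∀ j l, ContDiffOn ℝ r (fun x => F l v (ψ j v x)) (𝕀^ℓ)) ∧
        (∀ j l, ∀ q ≤ r, ∀ x ∈ 𝕀^ℓ, ‖iteratedFDeriv ℝ q (fun x => F l v (ψ j v x)) x‖ ≤ 1) := by
  obtain ⟨κ, hκ, ψ, hψdef, hψ⟩ := h n m F hF hbd
  refine ⟨κ, hκ, ψ, hψdef, fun v => ?_⟩
  obtain ⟨h1, h2, h3, h4, h5, h6⟩ := hψ v
  have hrr : ((r : ℕ) : WithTop ℕ∞) ≤ ((r' : ℕ) : WithTop ℕ∞) := by exact_mod_cast hr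
  exact ⟨h1, h2, fun j c => (h3 j c).of_le hrr, fun j c q hq x hx => h4 j c q (hq.trans hr) x hx,
    fun j l => (h5 j l).of_le hrr, fun j l q hq x hx => h6 j l q (hq.trans hr) x hx⟩

/-- **Composition of a chart with a function smooth on an open set** (Bhardwaj–van den Dries
2022, Lemma 4.4 shape): if `φ` is `C^r` on an open `t ⊆ ℝ^{ℓ'}` with `‖D^q φ‖ ≤ C` on `t`, and
`ψ : (0,1)^ℓ → t` has `C^r` coordinates with `‖D^i ψ_c‖ ≤ D^i` (`1 ≤ i ≤ r`, `D ≥ 0`), then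
`φ ∘ ψ` is `C^r` on `(0,1)^ℓ` with `‖D^q(φ ∘ ψ)‖ ≤ q!·C·D^q`. [cite: BhardwajVanDenDries2022, Lemma 4.4] -/
theorem contDiffOn_norm_iteratedFDeriv_comp_open {ℓ ℓ' r : ℕ} {φ : (Fin ℓ' → ℝ) → ℝ}
    {ψ : (Fin ℓ → ℝ) → (Fin ℓ' → ℝ)} {t : Set (Fin ℓ' → ℝ)} (hto : IsOpen t) {C D : ℝ} (hD0 : 0 ≤ D)
    (hφ : ContDiffOn ℝ r φ t)
    (hbφ : ∀ q ≤ r, ∀ y ∈ t, ‖iteratedFDeriv ℝ q φ y‖ ≤ C)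
    (hψ : ∀ c, ContDiffOn ℝ r (fun x => ψ x c) (𝕀^ℓ))
    (hmaps : MapsTo ψ (𝕀^ℓ) t)
    (hbψ : ∀ c, ∀ q, 1 ≤ q → q ≤ r → ∀ x ∈ 𝕀^ℓ, ‖iteratedFDeriv ℝ q (fun x => ψ x c) x‖ ≤ D ^ q) :
    ContDiffOn ℝ r (fun x => φ (ψ x)) (𝕀^ℓ) ∧
      ∀ q ≤ r, ∀ x ∈ 𝕀^ℓ, ‖iteratedFDeriv ℝ q (fun x => φ (ψ x)) x‖ ≤ q.factorial * C * D ^ q := by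
  set s : Set (Fin ℓ → ℝ) := 𝕀^ℓ with hs
  have hso : IsOpen s := isOpen_set_pi finite_univ fun _ _ => isOpen_Ioo
  have hψ' : ContDiffOn ℝ r ψ s := contDiffOn_pi' hψ
  refine ⟨hφ.comp hψ' hmaps, fun q hq x hx => ?_⟩
  rw [← iteratedFDerivWithin_of_isOpen q hso hx]
  have h := norm_iteratedFDerivWithin_comp_le (n := q) (N := (r : WithTop ℕ∞)) hφ hψ' (by exact_mod_cast hq)
    hto.uniqueDiffOn hso.uniqueDiffOn hmaps hx (C := C) (D := D) ?_ ?_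
  · exact h
  · intro i hi
    rw [iteratedFDerivWithin_of_isOpen i hto (hmaps hx)]
    exact hbφ i (hi.trans hq) _ (hmaps hx)
  · intro i hi1 hi
    refine norm_iteratedFDerivWithin_pi_le (N := (r : WithTop ℕ∞)) hψ hso.uniqueDiffOn hx
      (by exact_mod_cast hi.trans hq) (by positivity) fun c => ?_
    rw [iteratedFDerivWithin_of_isOpen i hso hx]
    exact hbψ c i hi1 (hi.trans hq) x hx

end Mono


end Literature.ModelTheory.ExponentialFields

end
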